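import Mathlib.AlgebraicGeometry.Sites.ElladicCohomology
import Mathlib.FieldTheory.IsAlgClosed.AlgebraicClosure
import Literature.AlgebraicGeometry.Motives.Varieties
import HarnessLib

/-!
# The `ℓ`-adic cohomology groups of a smooth projective variety (named facts)

Mathlib's `AlgebraicGeometry.Scheme.EllAdicCohomology X ℓ i` is the pro-étale cohomology group
`Hⁱ(X_proét, 𝓞_{ℚ_ℓ,X})` of Bhatt–Scholze (the sheaf `U ↦ C(U, ℤ_ℓ)` of Def. 6.8.1 on the small
pro-étale site of Def. 4.1.1, cohomology = `Ext` from the constant sheaf `ℤ`), an additive group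
in `Type (u + 1)` without (as yet) a `ℤ_ℓ`-module structure, functoriality in `X`, products or a
Galois action. This file records, as **named facts** (statements only, D-0014), what the
classical theory says about these *groups* for the base change `X_{k̄}` of a smooth projective
geometrically irreducible variety `X` of dimension `n` over a field `k` to `k̄ = AlgebraicClosure k`,
`ℓ` a prime invertible in `k`:

* `Literature.AlgebraicGeometry.Motives.geometricEllAdicCohomology k X ℓ i` : the group
  `Hⁱ_proét(X_{k̄}, ℤ_ℓ)` (an `abbrev` for Mathlib's group of the base change; the object that
  `EtaleRealization.IsProetaleModel` pins a Galois Weil cohomology theory to);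
* `…exists_addEquiv_geometricEllAdicCohomology` : it is, as a group, `ℤ_ℓ^b × T` with `T` finite
  (a finitely generated `ℤ_ℓ`-module);
* `…nonempty_addEquiv_geometricEllAdicCohomology_zero` : `H⁰ ≅ ℤ_ℓ` (discharged:
  `nonempty_addEquiv_geometricEllAdicCohomology_zero_holds`, `EllAdicCohomologyGroupsProofs.lean`).

These are the group-level shadows of the axioms `finite_obj` and (Poincaré duality in degree `0`)
`finrank_obj_zero` of `Literature.AlgebraicGeometry.Motives.WeilCohomology`
for the intended witness `X ↦ ℚ ⊗ H•_proét(X_{k̄}, ℤ_ℓ)` of the existence fact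
`Literature.AlgebraicGeometry.Motives.exists_galoisWeilCohomology_hasLefschetzTraceFormula`
(`EllAdicWeilCohomology.lean`); they are among the few constituents of that fact that can be stated
on an existing carrier, Mathlib having no pull-backs, cup products, trace or cycle classes for
`EllAdicCohomology` yet. Two further shadows are **not** recorded here as named facts but are
derived statements, each the explicit conclusion of a proved reduction theorem elsewhere:
the shadow of `subsingleton_obj` — vanishing of `Hⁱ_proét(X_{k̄}, ℤ_ℓ)` for `i > 2n` (Milne VI
Thm. 1.1 with VI Cor. 2.8 and Bhatt–Scholze Prop. 5.6.2; Deligne, *Weil I*, (1.3) with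
`ℚ_ℓ`-coefficients) — is proved from Milne VI Thm. 1.1, taken as an explicit hypothesis in the
vendored form stated in `EllAdicComparison.lean` (not a named fact of the tree: D-0026 split
review of 2026-08-15), and the primary named facts Milne VI Cor. 2.8
(`finite_etaleCohomology_of_isProper`) and Bhatt–Scholze Prop. 5.6.2
(`ellAdicCohomology_limOneSequence`) as the theorem
`Literature.AlgebraicGeometry.Motives.subsingleton_geometricEllAdicCohomology_of_lt_of_facts` of
`EllAdicComparison.lean` (and, without VI Cor. 2.8, as
`subsingleton_geometricEllAdicCohomology_of_lt_of_cd_of_comparison` there); and the shadow of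
`bijective_trace` — `H²ⁿ_proét(X_{k̄}, ℤ_ℓ) ≅ ℤ_ℓ`
(Milne VI Thm. 11.1 (a) / Lemma 11.3, `η(Y) : H²ⁿ_c(Y, Λ(n)) ≅ Λ`, with `H_c = H` for complete
`Y`, `Λ(n) ≈ Λ` over the separably closed `k̄`, passage to `lim_m` (Milne V §1) and the
comparison chain below; Deligne, *Weil I*, (2.2)–(2.3): `Tr : H²ⁿ(X, ℚ_ℓ) → ℚ_ℓ(-n)`) — is proved
from Milne VI Cor. 2.8, Bhatt–Scholze Prop. 5.6.2 and Milne VI Thm. 11.1 (a) in finite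
coefficients (an explicit hypothesis) as the theorem
`Literature.AlgebraicGeometry.Motives.nonempty_addEquiv_geometricEllAdicCohomology_two_mul_of_facts`
of `EllAdicTopDegree.lean`. (The standalone facts `subsingleton_geometricEllAdicCohomology_of_lt`
and `nonempty_addEquiv_geometricEllAdicCohomology_two_mul` formerly declared in this file were
retired under D-0026: neither is a primary printed theorem — each is a composite of three —, neither
had a consumer, and neither is a constituent from which the existence fact is glued.)

## The comparison with classical `ℓ`-adic cohomology (used in every docstring below)

For a scheme `Y` write `Hⁱ(Y, ℤ/ℓᵐ)` for étale cohomology. The chain is: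
`Hⁱ_proét(Y, ℤ_ℓ)` (Mathlib) `= Hⁱ(Y_proét, lim_m ν*(ℤ/ℓᵐ))` (Bhatt–Scholze, Def. 6.8.1 and
Lemma 6.8.2 (1): `𝓞_{E,Y} = lim 𝓞_E/ϖᵐ`; Lemma 4.2.12) `= Hⁱ_cont(Y_ét, (ℤ/ℓᵐ)_m)` (Prop. 5.6.2),
computed by `RΓ(Y_proét, R lim ν* ℤ/ℓᵐ) = R lim RΓ(Y_ét, ℤ/ℓᵐ)` (Prop. 3.1.10: `lim = R lim` for
surjective systems in the replete topos `Shv(Y_proét)`; Cor. 5.1.6: `RΓ(Y_proét, ν* K) = RΓ(Y_ét, K)`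
for `K ∈ D⁺`), whence short exact sequences
`0 → lim¹_m Hⁱ⁻¹(Y, ℤ/ℓᵐ) → Hⁱ_proét(Y, ℤ_ℓ) → lim_m Hⁱ(Y, ℤ/ℓᵐ) → 0`.
For `Y = X_{k̄}` proper over the separably closed field `k̄` every `Hⁱ(Y, ℤ/ℓᵐ)` is finite
(Milne, *Étale cohomology*, VI Cor. 2.8), so `lim¹ = 0` (Mittag-Leffler) and
`Hⁱ_proét(X_{k̄}, ℤ_ℓ) = lim_m Hⁱ(X_{k̄}, ℤ/ℓᵐ) = Hⁱ(X_{k̄}, ℤ_ℓ)`, the classical `ℓ`-adic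
cohomology (Milne V §1, cohomology of the `ℓ`-adic sheaf `(ℤ/ℓᵐ)_m`; Deligne, *Weil I*, (1.3),
(2.14) A)).

## References

* B. Bhatt, P. Scholze, *The pro-étale topology for schemes*, Astérisque 369 (2015):
  Def. 4.1.1, Lemma 4.2.12, Prop. 3.1.10, Cor. 5.1.6, Prop. 5.6.2, Def. 6.8.1, Lemma 6.8.2.
  [BhattScholze2015]
* J. S. Milne, *Étale cohomology*, Princeton University Press (held reissue, 2025): V Lemma 1.11
  (`Hʳ(X, F)` finitely generated over `ℤ_ℓ` when the `Hʳ(X, F_n)` are finite; held copy p. 177),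
  VI Thm. 1.1 (`cd_ℓ(X_ét) ≤ 2 dim X`; p. 234), VI Cor. 2.8 (finiteness for proper `X`; p. 238),
  VI Thm. 11.1 (a) (`η(X) : H²ᵈ_c(X, Λ(d)) ≅ Λ`; p. 288); "variety" = geometrically reduced and
  irreducible scheme of finite type over a field (Terminology, p. 7). [Milne2025]
* P. Deligne, *La conjecture de Weil. I*, Publ. Math. IHÉS 43 (1974), (1.3), (2.2)–(2.3),
  (2.14) A), B). [Deligne1974]

## Design notes

* Group level only: Mathlib's `EllAdicCohomology` carries no `ℤ_ℓ`-module structure, so "finitely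
  generated `ℤ_ℓ`-module" is recorded through its consequence for the underlying group
  (`ℤ_ℓ^b × T`, `T` finite, by the structure theorem over the PID `ℤ_ℓ`), and `Hⁱ ≅ ℤ_ℓ` as
  `Nonempty (… ≃+ ℤ_[ℓ])` (abstract isomorphisms; the canonical ones need the missing structure).
* Hypotheses mirror `exists_galoisWeilCohomology_hasLefschetzTraceFormula`:
  `IsSmoothProjective n X` (smooth of relative dimension `n`, projective, geometrically
  irreducible — so `X_{k̄}` is a smooth complete irreducible variety of dimension `n` over the
  algebraically closed field `k̄`, the setting of Milne V–VI) and `(ℓ : k) ≠ 0`.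
* Universes: `k : Type u`, `X : SchemeOver k`, the groups live in `Type (u + 1)` (Mathlib); the
  targets `ℤ_[ℓ]`, `Fin b → ℤ_[ℓ]`, `T : Type` live in `Type`; `≃+` is universe polymorphic.
* Mathlib searches: `EllAdicCohomology` (only `isZero_ellAdicSheaf_of_isEmpty` and the
  `Subsingleton` instance for empty `X`), `Sheaf.H` (no computation in degree `0` yet, see the TODO
  in `Mathlib/CategoryTheory/Sites/SheafCohomology/Basic.lean`); nothing to reuse or to contradict.
-/

universe u

open CategoryTheory AlgebraicGeometry

noncomputable section

namespace Literature.AlgebraicGeometry.Motives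

variable (k : Type u) [Field k]

/-- The **geometric `ℓ`-adic cohomology group** `Hⁱ_proét(X_{k̄}, ℤ_ℓ)` of a `k`-scheme `X`:
Mathlib's pro-étale `ℓ`-adic cohomology `Scheme.EllAdicCohomology` (Bhatt–Scholze 2015,
Def. 6.8.1: cohomology of the sheaf `U ↦ C(U, ℤ_ℓ)` on the small pro-étale site) of the base change
`X_{k̄} = X ×_k Spec k̄`, `k̄ = AlgebraicClosure k` (`Literature.AlgebraicGeometry.Motives.baseChange`).
An additive group in `Type (u + 1)`; this is the group to which
`EtaleRealization.IsProetaleModel` compares `Hⁱ(X)` of a Galois Weil cohomology theory.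
[cite: BhattScholze2015, Def. 6.8.1] -/
abbrev geometricEllAdicCohomology (X : SchemeOver k) (ℓ : ℕ) [Fact ℓ.Prime] (i : ℕ) :
    Type (u + 1) :=
  ((baseChange k (AlgebraicClosure k)).obj X).left.EllAdicCohomology ℓ i

/-- Unfolding lemma: `geometricEllAdicCohomology k X ℓ i` is Mathlib's `EllAdicCohomology ℓ i` of
the base change of `X` to `AlgebraicClosure k` (by `rfl`). [folklore] -/
theorem geometricEllAdicCohomology_def (X : SchemeOver k) (ℓ : ℕ) [Fact ℓ.Prime] (i : ℕ) :
    geometricEllAdicCohomology k X ℓ i =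
      ((baseChange k (AlgebraicClosure k)).obj X).left.EllAdicCohomology ℓ i :=
  rfl

/-- **Finiteness of `ℓ`-adic cohomology** (named fact, statement only). For `X` smooth projective
geometrically irreducible of dimension `n` over `k` and `ℓ` a prime invertible in `k`, every group
`Hⁱ_proét(X_{k̄}, ℤ_ℓ)` is isomorphic to `ℤ_ℓ^b × T` with `T` a finite abelian group, i.e. it is
the additive group of a finitely generated `ℤ_ℓ`-module. Printed sources: `Hⁱ(X_{k̄}, ℤ/ℓᵐ)` is
finite for all `i, m` since `X_{k̄}` is proper over the separably closed `k̄` (Milne VI Cor. 2.8);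
hence `Hⁱ(X_{k̄}, ℤ_ℓ) := lim_m Hⁱ(X_{k̄}, ℤ/ℓᵐ)` is a finitely generated `ℤ_ℓ`-module (Milne V
Lemma 1.11, applied to the flat `ℓ`-adic sheaf `(ℤ/ℓᵐ)_m`), so of the form `ℤ_ℓ^b ⊕ ⨁ ℤ_ℓ/ℓ^{e_j}`;
and `Hⁱ_proét(X_{k̄}, ℤ_ℓ) = lim_m Hⁱ(X_{k̄}, ℤ/ℓᵐ)` by the comparison chain of the module
docstring (Bhatt–Scholze Def. 6.8.1, Lemma 6.8.2, Prop. 5.6.2, Prop. 3.1.10, Cor. 5.1.6; the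
`lim¹` term vanishes by finiteness). With `ℚ_ℓ`-coefficients this is Deligne, *Weil I*, (1.3):
"Les `Hⁱ(X, ℚ_ℓ)` sont des espaces vectoriels de dimension finie sur `ℚ_ℓ`". The group-level
shadow of the axiom `WeilCohomology.finite_obj` for `ℓ`-adic cohomology.
[cite: Milne2025, V Lemma 1.11 and VI Cor. 2.8] [cite: BhattScholze2015, Prop. 5.6.2 and Lemma 6.8.2]
[cite: Deligne1974, (1.3)] -/
def exists_addEquiv_geometricEllAdicCohomology : Prop :=
  ∀ ⦃n : ℕ⦄ ⦃X : SchemeOver k⦄, IsSmoothProjective n X → ∀ (ℓ : ℕ) [Fact ℓ.Prime], (ℓ : k) ≠ 0 →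
    ∀ i : ℕ, ∃ (b : ℕ) (T : Type) (_ : AddCommGroup T) (_ : Finite T),
      Nonempty (geometricEllAdicCohomology k X ℓ i ≃+ (Fin b → ℤ_[ℓ]) × T)

/-- **`H⁰` of a geometrically irreducible variety** (named fact, statement only). For `X` smooth
projective geometrically irreducible of dimension `n` over `k` and `ℓ` a prime invertible in `k`,
`H⁰_proét(X_{k̄}, ℤ_ℓ) ≅ ℤ_ℓ` as additive groups. Printed sources: `H⁰` of the topos `Shv(Y_proét)`
with values in a sheaf `F` is `F(Y)` (`Y` is the final object of `Y_proét`, Bhatt–Scholze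
Def. 4.1.1 and Lemma 4.1.8), and `𝓞_{ℚ_ℓ,Y}(Y) = C(Y, ℤ_ℓ)` (Def. 6.8.1, Lemma 4.2.12), the continuous
maps from the underlying space of `Y = X_{k̄}` to `ℤ_ℓ`; `X_{k̄}` is irreducible (geometric
irreducibility of `X`), hence connected and non-empty, and `ℤ_ℓ` is totally disconnected, so
`C(X_{k̄}, ℤ_ℓ) = ℤ_ℓ` (the constant maps). Equivalently, via the comparison chain,
`lim_m H⁰(X_{k̄}, ℤ/ℓᵐ) = lim_m ℤ/ℓᵐ = ℤ_ℓ`. The group-level shadow of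
`WeilCohomology.finrank_obj_zero` (`dim H⁰(X) = 1`) for `ℓ`-adic cohomology.
[cite: BhattScholze2015, Def. 6.8.1 and Lemma 4.2.12] -/
def nonempty_addEquiv_geometricEllAdicCohomology_zero : Prop :=
  ∀ ⦃n : ℕ⦄ ⦃X : SchemeOver k⦄, IsSmoothProjective n X → ∀ (ℓ : ℕ) [Fact ℓ.Prime], (ℓ : k) ≠ 0 →
    Nonempty (geometricEllAdicCohomology k X ℓ 0 ≃+ ℤ_[ℓ])

variable {k}

/-- From the finiteness fact: `Hⁱ_proét(X_{k̄}, ℤ_ℓ)` is a quotient (indeed an isomorphic image)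
of a group `ℤ_ℓ^b × T` with `T` finite (unfolding lemma; Milne V Lemma 1.11). [folklore] -/
theorem exists_addEquiv_geometricEllAdicCohomology.exists_surjective
    (h : exists_addEquiv_geometricEllAdicCohomology k) {n : ℕ} {X : SchemeOver k}
    (hX : IsSmoothProjective n X) (ℓ : ℕ) [Fact ℓ.Prime] (hℓ : (ℓ : k) ≠ 0) (i : ℕ) :
    ∃ (b : ℕ) (T : Type) (_ : AddCommGroup T) (_ : Finite T)
      (f : (Fin b → ℤ_[ℓ]) × T →+ geometricEllAdicCohomology k X ℓ i), Function.Surjective f := by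
  obtain ⟨b, T, _, _, ⟨e⟩⟩ := h hX ℓ hℓ i
  exact ⟨b, T, inferInstance, inferInstance, e.symm.toAddMonoidHom, e.symm.surjective⟩

/-- From the degree-zero fact: `H⁰_proét(X_{k̄}, ℤ_ℓ)` is a non-trivial group (it is `≅ ℤ_ℓ`;
Bhatt–Scholze Lemma 4.2.12). [folklore] -/
theorem nonempty_addEquiv_geometricEllAdicCohomology_zero.nontrivial
    (h : nonempty_addEquiv_geometricEllAdicCohomology_zero k) {n : ℕ} {X : SchemeOver k}
    (hX : IsSmoothProjective n X) (ℓ : ℕ) [Fact ℓ.Prime] (hℓ : (ℓ : k) ≠ 0) :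
    Nontrivial (geometricEllAdicCohomology k X ℓ 0) := by
  obtain ⟨e⟩ := h hX ℓ hℓ
  exact e.symm.injective.nontrivial

end Literature.AlgebraicGeometry.Motives

end
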